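import Literature.NumberTheory.DiophantineGeometry.FunctionFieldDivisors
import Literature.NumberTheory.DiophantineGeometry.FunctionFieldDivisorsConstantsProofs
import HarnessLib

/-!
# Linearly equivalent divisors have equidimensional Riemann–Roch spaces — discharged fact

Proof of the named fact `Literature.NumberTheory.DiophantineGeometry.AlgFunctionField.ell_congr_of_isLinearlyEquivalent` stated in
`Literature.NumberTheory.DiophantineGeometry.FunctionFieldDivisors` (kept in a sibling file so
that the statement file stays a definitions/named-facts file):

* `Literature.AlgFunctionField.ell_congr_of_isLinearlyEquivalent_holds : ell_congr_of_isLinearlyEquivalent`,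
  i.e. for divisors `D ∼ D'` of an arbitrary field extension `F/K`, `ℓ(D) = ℓ(D')`.

## Source and proof architecture

H. Stichtenoth, *Algebraic Function Fields and Codes*, 2nd ed., GTM 254 (2009), §1.4,
Lemma 1.4.6 (b) (first-edition numbering I.4.6 (b), as quoted in the fact's docstring; held copy
ISBN 978-3-540-76877-7, PDF pp. 25–26): *"If `A'` is a divisor equivalent to `A`, then
`ℒ(A) ≃ ℒ(A')` (isomorphic as vector spaces over `K`)."* Here `A' ∼ A` means `A = A' + (x)` for
some `0 ≠ x ∈ F` (Def. 1.4.3) and `ℒ(A) = {x ∈ F | (x) ≥ -A} ∪ {0}` (Def. 1.4.4). Printed proof: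
write `A = A' + (z)` with `0 ≠ z ∈ F`; then `φ : ℒ(A) → F, x ↦ x z` is `K`-linear with image in
`ℒ(A')` (because `v_P(x z) = v_P(x) + v_P(z) ≥ -v_P(A) + v_P(A) - v_P(A') = -v_P(A')`), and
`φ' : x ↦ x z⁻¹` maps `ℒ(A')` back into `ℒ(A)`; *"These mappings are inverse to each other, hence
`φ` is an isomorphism between `ℒ(A)` and `ℒ(A')`."* Equal dimensions `ℓ(A) = ℓ(A')`
(`ℓ(A) := dim ℒ(A)`, Def. 1.4.10, PDF p. 27) follow.

In Lean the Riemann–Roch space `riemannRochSpace D` is cut out by the abstract valuations,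
`x ∈ L(D) ↔ ∀ v, v(x) ≤ v(π_v) ^ (-D v)`, while principal divisors are built from the normalised
order `PlaceOver.ord`. The one bridge needed is

* `PlaceOver.valuation_eq_zpow_ord`: `v(x) = v(π_v) ^ (ord_v x)` for `x ≠ 0` (Stichtenoth
  Thm. 1.1.6 / Def. 1.1.12: `x = u π_vⁿ` with `u ∈ O_v^×`, `v_P(x) := n`; in Mathlib
  `IsDiscreteValuationRing.eq_unit_mul_pow_irreducible`, `IsDiscreteValuationRing.addVal_def`
  and `ValuationSubring.valuation_unit`), proved separately on `O_v` and, via `x⁻¹`, off `O_v`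
  (the unfolding lemma `PlaceOver.ord_of_mem` is reused from the sibling
  `FunctionFieldDivisorsConstantsProofs`; off `O_v` the definition of `ord` is unfolded in place).

With it, multiplication by `x` (resp. `x⁻¹`) maps `L(D)` into `L(D')` whenever
`D = D' + (x)` pointwise (`mul_mem_riemannRochSpace`), giving a `K`-linear isomorphism
`L(D) ≃ₗ[K] L(D')`, `y ↦ x y` (`exists_riemannRochSpace_linearEquiv_coe_eq_mul`), and
`ℓ(D) = ℓ(D')` (`LinearEquiv.finrank_eq`).
The vendored `principalDivisor` has the junk value `0` when `{v | ord_v x ≠ 0}` is infinite; in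
that case `D ∼ D'` reads `D - D' = 0`, so `D = D'` and the conclusion is trivial. No
function-field hypothesis (`trdeg = 1`, finite generation) is used, exactly as in the printed
proof, which only needs `v_P(x z) = v_P(x) + v_P(z)`.

## References

* H. Stichtenoth, *Algebraic Function Fields and Codes*, GTM 254, Springer 2009, §1.1
  (Thm. 1.1.6, Def. 1.1.12, Thm. 1.1.13) and §1.4 (Def. 1.4.1–1.4.4, Lemma 1.4.6 (b),
  Def. 1.4.10).
-/

noncomputable section

namespace Literature.NumberTheory.DiophantineGeometry.AlgFunctionField

universe u v

variable {K : Type u} {F : Type v} [Field K] [Field F] [Algebra K F]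

namespace PlaceOver

/-- The uniformizer has nonzero valuation (it is a nonzero element of `F`). [folklore] -/
theorem valuation_uniformizer_ne_zero (v : PlaceOver K F) :
    v.valuation (v.uniformizer : F) ≠ 0 :=
  (Valuation.ne_zero_iff _).2 fun h ↦ v.irreducible_uniformizer.ne_zero (Subtype.ext h)

/-- For a nonzero `a ∈ O_v`: `v(a) = v(π_v) ^ addVal(a)` (Stichtenoth Thm. 1.1.6 (b) and
Def. 1.1.12: `a = u π_vⁿ` with `u ∈ O_v^×` and `n = v_P(a)`; Mathlib's
`IsDiscreteValuationRing.eq_unit_mul_pow_irreducible` and `addVal_def`, units having valuation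
`1` by `ValuationSubring.valuation_unit`). [cite: Stichtenoth2009, Thm. 1.1.6(b), Def. 1.1.12] -/
theorem valuation_coe_eq_pow_addVal (v : PlaceOver K F) {a : v.toValuationSubring} (ha : a ≠ 0) :
    v.valuation (a : F) = v.valuation (v.uniformizer : F) ^
      (IsDiscreteValuationRing.addVal v.toValuationSubring a).toNat := by
  obtain ⟨n, u, hu⟩ :=
    IsDiscreteValuationRing.eq_unit_mul_pow_irreducible ha v.irreducible_uniformizer
  rw [IsDiscreteValuationRing.addVal_def a u v.irreducible_uniformizer n hu, ENat.toNat_coe, hu]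
  simp only [MulMemClass.coe_mul, SubmonoidClass.coe_pow, map_mul, map_pow,
    ValuationSubring.valuation_unit, one_mul]

/-- **Bridge between the abstract valuation and the normalised order**: for `0 ≠ x ∈ F`,
`v(x) = v(π_v) ^ (ord_v x)` in the value group of `O_v` (Stichtenoth Thm. 1.1.6 (b),
Def. 1.1.12, Thm. 1.1.13: every `0 ≠ x ∈ F` is `u π_vⁿ` with `u ∈ O_v^×`, `n = v_P(x) ∈ ℤ`).
On `O_v` this is `valuation_coe_eq_pow_addVal`; off `O_v` it is the same statement for
`x⁻¹ ∈ O_v`, inverted. [cite: Stichtenoth2009, Thm. 1.1.6(b), Def. 1.1.12] -/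
theorem valuation_eq_zpow_ord (v : PlaceOver K F) {x : F} (hx0 : x ≠ 0) :
    v.valuation x = v.valuation (v.uniformizer : F) ^ v.ord x := by
  by_cases hx : x ∈ v.toValuationSubring
  · have ha : (⟨x, hx⟩ : v.toValuationSubring) ≠ 0 := fun h ↦ hx0 (congrArg Subtype.val h)
    rw [ord_of_mem v hx, zpow_natCast]
    exact v.valuation_coe_eq_pow_addVal ha
  · have hx' : x⁻¹ ∈ v.toValuationSubring :=
      (v.toValuationSubring.mem_or_inv_mem x).resolve_left hx
    have ha : (⟨x⁻¹, hx'⟩ : v.toValuationSubring) ≠ 0 := fun h ↦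
      inv_ne_zero hx0 (congrArg Subtype.val h)
    -- off `O_v`, `ord_v x = -addVal (x⁻¹)` by definition (Stichtenoth Def. 1.1.12)
    have hord : v.ord x = -((IsDiscreteValuationRing.addVal v.toValuationSubring
        ⟨x⁻¹, hx'⟩).toNat : ℤ) := by
      simp only [ord, dif_neg hx]
    rw [hord, zpow_neg, zpow_natCast, ← v.valuation_coe_eq_pow_addVal ha, map_inv₀, inv_inv]

/-- `ord_v (x⁻¹) = -ord_v x` for `x ≠ 0` (Stichtenoth Def. 1.1.9 (2) with `v(1) = 0`), read off
from `valuation_eq_zpow_ord` and injectivity of `n ↦ v(π_v)ⁿ` (`v(π_v) < 1`).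
[cite: Stichtenoth2009, Def. 1.1.9(2), Thm. 1.1.13] -/
theorem ord_inv (v : PlaceOver K F) {x : F} (hx0 : x ≠ 0) : v.ord x⁻¹ = -v.ord x := by
  have h1 : v.valuation (v.uniformizer : F) < 1 :=
    (v.toValuationSubring.valuation_lt_one_iff _).1
      ((IsLocalRing.mem_maximalIdeal _).2 (mem_nonunits_iff.2 v.irreducible_uniformizer.not_isUnit))
  have h := v.valuation_eq_zpow_ord (inv_ne_zero hx0)
  rw [map_inv₀, v.valuation_eq_zpow_ord hx0, ← zpow_neg] at h
  exact ((zpow_right_strictAnti₀ (zero_lt_iff.2 v.valuation_uniformizer_ne_zero) h1).injective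
    h).symm

end PlaceOver

/-- Multiplication by `x` maps `L(D)` into `L(D')` as soon as `v(x) = v(π_v) ^ (n v)` and
`D = D' + n` pointwise (Stichtenoth, proof of Lemma 1.4.6 (b): `x ∈ ℒ(A)`, `A = A' + (z)`
`⇒ x z ∈ ℒ(A')`, since `v_P(x z) = v_P(x) + v_P(z) ≥ -v_P(A')`). Stated with an abstract
exponent `n` so that it applies to `z` (`n = ord z`) and to `z⁻¹` (`n = -ord z`) alike.
[cite: Stichtenoth2009, proof of Lemma 1.4.6(b)] -/
theorem mul_mem_riemannRochSpace {D D' : Divisor K F} {x : F} {n : PlaceOver K F → ℤ}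
    (hx : ∀ v : PlaceOver K F, v.valuation x = v.valuation (v.uniformizer : F) ^ n v)
    (hD : ∀ v : PlaceOver K F, D v = D' v + n v) {y : F} (hy : y ∈ riemannRochSpace D) :
    x * y ∈ riemannRochSpace D' := by
  intro v
  rw [Valuation.map_mul, hx v]
  calc v.valuation (v.uniformizer : F) ^ n v * v.valuation y
      ≤ v.valuation (v.uniformizer : F) ^ n v * v.valuation (v.uniformizer : F) ^ (-(D v)) :=
        mul_le_mul_right (hy v) _
    _ = v.valuation (v.uniformizer : F) ^ (-(D' v)) := by
        rw [← zpow_add₀ v.valuation_uniformizer_ne_zero, hD v]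
        congr 1
        ring

/-- **Stichtenoth Lemma 1.4.6 (b)** (the isomorphism): if `0 ≠ x ∈ F` and `D = D' + (x)`
pointwise, i.e. `D v = D' v + ord_v x` for every place `v`, then there is a `K`-linear
isomorphism `L(D) ≃ L(D')` given by `y ↦ x y` (its inverse is `y ↦ x⁻¹ y`); these are the printed
maps `φ`, `φ'`. Stated as an existence statement recording that the isomorphism *is*
multiplication by `x`. [cite: Stichtenoth2009, Lemma 1.4.6(b)] -/
theorem exists_riemannRochSpace_linearEquiv_coe_eq_mul {D D' : Divisor K F} {x : F} (hx0 : x ≠ 0)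
    (hD : ∀ v : PlaceOver K F, D v = D' v + v.ord x) :
    ∃ e : riemannRochSpace D ≃ₗ[K] riemannRochSpace D', ∀ y : riemannRochSpace D,
      (e y : F) = x * y :=
  ⟨{ toFun := fun y ↦
        ⟨x * y, mul_mem_riemannRochSpace (fun v ↦ v.valuation_eq_zpow_ord hx0) hD y.2⟩,
      invFun := fun y ↦ ⟨x⁻¹ * y, mul_mem_riemannRochSpace (n := fun v ↦ -v.ord x)
        (fun v ↦ by rw [map_inv₀, v.valuation_eq_zpow_ord hx0, zpow_neg])
        (fun v ↦ by rw [hD v]; ring) y.2⟩,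
      map_add' := fun y z ↦ by ext; simp [mul_add],
      map_smul' := fun c y ↦ by ext; simp,
      left_inv := fun y ↦ by ext; simp [hx0],
      right_inv := fun y ↦ by ext; simp [hx0] }, fun _ ↦ rfl⟩

/-- In the junk case of `principalDivisor` (infinitely many places with `ord_v x ≠ 0`) the
principal divisor is `0` by definition. [folklore] -/
theorem principalDivisor_of_not_finite {x : F} (h : ¬ {v : PlaceOver K F | v.ord x ≠ 0}.Finite) :
    principalDivisor K x = 0 := by
  unfold principalDivisor
  rw [dif_neg h]

/-- **Discharge of `ell_congr_of_isLinearlyEquivalent`** (Stichtenoth Lemma 1.4.6 (b) with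
Def. 1.4.3, 1.4.4, 1.4.10: `A ∼ A' ⇒ ℒ(A) ≃ ℒ(A')` as `K`-vector spaces, hence
`ℓ(A) = dim ℒ(A) = dim ℒ(A') = ℓ(A')`), for an arbitrary extension `F/K`. Proof: `D ∼ D'` gives `0 ≠ x` with `(x) = D - D'`. Off the junk case
of `principalDivisor`, `D v = D' v + ord_v x` for all `v` (`principalDivisor_apply`), and
`exists_riemannRochSpace_linearEquiv_coe_eq_mul` (multiplication by `x`, inverse multiplication
by `x⁻¹`, exactly the printed maps `φ`, `φ'`) provides a `K`-linear isomorphism `L(D) ≃ L(D')`,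
so the `finrank`s agree
(`LinearEquiv.finrank_eq`; this also covers the infinite-dimensional junk value `ℓ = 0` of
`Module.finrank`, which is invariant under linear isomorphism). In the junk case `(x) = 0`, so
`D - D' = 0` and `D = D'`. [cite: Stichtenoth2009, Lemma 1.4.6(b), Def. 1.4.10] -/
theorem ell_congr_of_isLinearlyEquivalent_holds :
    ell_congr_of_isLinearlyEquivalent (K := K) (F := F) := by
  intro D D' h
  obtain ⟨x, hx0, hx⟩ := h
  by_cases hfin : {v : PlaceOver K F | v.ord x ≠ 0}.Finite
  · have hD : ∀ v : PlaceOver K F, D v = D' v + v.ord x := fun v ↦ by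
      have := congrArg (fun E : Divisor K F ↦ E v) hx
      simp only [principalDivisor_apply hfin, Finsupp.coe_sub, Pi.sub_apply] at this
      omega
    obtain ⟨e, -⟩ := exists_riemannRochSpace_linearEquiv_coe_eq_mul (K := K) hx0 hD
    exact e.finrank_eq
  · rw [principalDivisor_of_not_finite hfin, eq_comm, sub_eq_zero] at hx
    rw [hx]

end Literature.NumberTheory.DiophantineGeometry.AlgFunctionField
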